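import Summits.CriticalPhenomena.PercolationContinuityZ3.Theorems.Transplant.SkelPhiWinChainFF2
import HarnessLib

/-!
# N2 (frames-only node `SamePDropOfSkeletonFrm₁`, OPEN), (R) column after J16/(R-38): **THE TARGET CHAIN OVER THREE WINDOWS, (S0)-SHAPE KITS** —
# `Skelφ.WinChainData.chainF₃` (`chainF₂` of segments 1–2, then segment 3; the families are `pw n₁₂ (stepAF₂ …) (P₃.stepAF 𝒲₃ S₃)` — no new definitions)

For the SECOND-AXIS root leg of record (R-38): hop → bridge (window 1, root frame) → x-PREFIX corridor (window 2, run frame at `c₁`) → y′-corridor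
(window 3, run frame at `c₂`), N1's B.17 three-leg architecture (`rootOblTWAt_of_bridgeG3`/`chainAt₃`) in the `KitsAtF` shape of `chainF₂` (p351810 ✓).
Two cross links: `𝒲₁.coreTF S₁ S₁.N ⊆ 𝒲₂.W (S₂.core 0)` and `𝒲₂.coreTF S₂ S₂.N ⊆ 𝒲₃.W (S₃.core 0)`.
builds on p205010 (kernel theorem, internal audit signed; external expert review pending) — nothing in this file uses p205010; nothing here is a claim about
the open node `SamePDropOfSkeletonFrm₁`.
Lane `prim-bschramm`, seat `prim-bschramm-p3` (gen 16; N2 design owner, (R) column owner); helper file (`--supports stmt-CriticalPhenomena-4575 --as helper`).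
[cite: KozmaNitzan2024, §4 Lemma 11 (pp. 22–23), Lemma 12 (pp. 23–25), p. 20 (Step IV)] [cite: MartineauTassion2017, §4.3 Lemma 4.2]
-/

noncomputable section

open MeasureTheory ProbabilityTheory
open scoped ENNReal

namespace Summit.CriticalPhenomena.PercolationContinuityZ3.Theorems.Transplant

namespace Skelφ

open Literature.Probability.Percolation Literature.Probability.LatticeModels SimpleGraph
open Literature.Probability.Percolation.KozmaNitzan
open KNLevels ChainPlanar

variable {V : Type} [DecidableEq V]

namespace WinChainData

variable {G' : SimpleGraph V} [G'.LocallyFinite]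
variable (P₁ P₂ : WinChainData V) (𝒲₁ 𝒲₂ : PlanarWindow G') (S₁ S₂ : SchedFrame)

/-- **THE TARGET CHAIN OVER THREE WINDOWS, (S0)-SHAPE KITS** (see the module docstring): segments 1–2 exactly as in `chainF₂`, segment 3
`(P₃, 𝒲₃, S₃)` of the same shape with the second cross link `𝒲₂.coreTF S₂ S₂.N ⊆ 𝒲₃.W (S₃.core 0)`; the concatenated families
`pw n₁₂ (stepAF₂ …) (P₃.stepAF 𝒲₃ S₃)` / `pw n₁₂ (coreTF₂ …) (𝒲₃.coreTF S₃)` on `Fin (n₁₂ + 1 + S₃.N + 1)`, `n₁₂ = S₁.N + 1 + S₂.N`, form a linked chain with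
constant source, `T' ⊆ T`, `KitsAtF` at every step, excess `≤ η`, first level `𝒲₁.W (S₁.core 0)` and last true target `𝒲₃.coreTF S₃ S₃.N`.
[cite: KozmaNitzan2024, §4 Lemma 11 (pp. 22–23), Lemma 12 (pp. 23–25)] -/
theorem chainF₃ (ho : P₂.o = P₁.o)
    (hRl₁ : P₁.Rlev + 1 ≤ S₁.R') (hRim₁ : ∀ k, P₁.Rim k ⊆ 𝒲₁.stepDF S₁ k) (hTne₁ : ∀ k ≤ S₁.N, (𝒲₁.coreTF S₁ k).Nonempty)
    (hRl₂ : P₂.Rlev + 1 ≤ S₂.R') (hRim₂ : ∀ k, P₂.Rim k ⊆ 𝒲₂.stepDF S₂ k) (hTne₂ : ∀ k ≤ S₂.N, (𝒲₂.coreTF S₂ k).Nonempty)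
    (hx : 𝒲₁.coreTF S₁ S₁.N ⊆ 𝒲₂.W (S₂.core 0))
    {p : unitInterval} {W' : Sym2 V → unitInterval} {Δ' : ℕ} {δ η : ℝ}
    (hsub₁ : ∀ k ≤ S₁.N, IsSubbox G' W' p (𝒲₁.stepDF S₁ k)) (hfin₁ : FinSupp W' P₁.Sfin) (hDS₁ : ∀ k ≤ S₁.N, 𝒲₁.stepDF S₁ k ⊆ P₁.Sfin)
    (ho₁ : ∀ k ≤ S₁.N, P₁.o ∉ 𝒲₁.stepDF S₁ k) (hoS₁ : P₁.o ∈ P₁.Sfin) (hj₁ : P₁.j₁ ≤ P₁.Rlev)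
    (hcount₁ : 1 / (1 - (p : ℝ)) ^ (Δ' * P₁.N) ≤ δ * ((Finset.Icc P₁.j₀ P₁.j₁).card : ℝ))
    (hkits₁ : ∀ k ≤ S₁.N, ∀ j ∈ Finset.Icc P₁.j₀ P₁.j₁, ∃ (σ : SData V) (Sz : Finset V),
      SHyp (P₁.stepLF 𝒲₁ S₁ k) j σ ∧ σ.N ≤ P₁.N ∧ (1 - (p : ℝ) ^ σ.sB) ^ σ.k ≤ δ ∧ Sz ⊆ 𝒲₁.stepDF S₁ k ∧ (∀ x ∈ σ.K, σ.face x ⊆ Sz) ∧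
      RelayClause (P₁.stepLF 𝒲₁ S₁ k) W' j σ Sz (P₁.coreEF 𝒲₁ S₁ k) (𝒲₁.stepDF S₁ k) δ)
    (hexc₁ : ∀ k ≤ S₁.N, (prodBernoulli W').real (⋃ t ∈ P₁.Rim k, openConn P₁.o t) ≤ η)
    (hsub₂ : ∀ k ≤ S₂.N, IsSubbox G' W' p (𝒲₂.stepDF S₂ k)) (hfin₂ : FinSupp W' P₂.Sfin) (hDS₂ : ∀ k ≤ S₂.N, 𝒲₂.stepDF S₂ k ⊆ P₂.Sfin)
    (ho₂ : ∀ k ≤ S₂.N, P₂.o ∉ 𝒲₂.stepDF S₂ k) (hoS₂ : P₂.o ∈ P₂.Sfin) (hj₂ : P₂.j₁ ≤ P₂.Rlev)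
    (hcount₂ : 1 / (1 - (p : ℝ)) ^ (Δ' * P₂.N) ≤ δ * ((Finset.Icc P₂.j₀ P₂.j₁).card : ℝ))
    (hkits₂ : ∀ k ≤ S₂.N, ∀ j ∈ Finset.Icc P₂.j₀ P₂.j₁, ∃ (σ : SData V) (Sz : Finset V),
      SHyp (P₂.stepLF 𝒲₂ S₂ k) j σ ∧ σ.N ≤ P₂.N ∧ (1 - (p : ℝ) ^ σ.sB) ^ σ.k ≤ δ ∧ Sz ⊆ 𝒲₂.stepDF S₂ k ∧ (∀ x ∈ σ.K, σ.face x ⊆ Sz) ∧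
      RelayClause (P₂.stepLF 𝒲₂ S₂ k) W' j σ Sz (P₂.coreEF 𝒲₂ S₂ k) (𝒲₂.stepDF S₂ k) δ)
    (hexc₂ : ∀ k ≤ S₂.N, (prodBernoulli W').real (⋃ t ∈ P₂.Rim k, openConn P₁.o t) ≤ η)
    -- segment 3 (same shape), its source, and the second cross link
    (P₃ : WinChainData V) (𝒲₃ : PlanarWindow G') (S₃ : SchedFrame) (ho₃ : P₃.o = P₁.o)
    (hRl₃ : P₃.Rlev + 1 ≤ S₃.R') (hRim₃ : ∀ k, P₃.Rim k ⊆ 𝒲₃.stepDF S₃ k) (hTne₃ : ∀ k ≤ S₃.N, (𝒲₃.coreTF S₃ k).Nonempty)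
    (hx₂ : 𝒲₂.coreTF S₂ S₂.N ⊆ 𝒲₃.W (S₃.core 0))
    (hsub₃ : ∀ k ≤ S₃.N, IsSubbox G' W' p (𝒲₃.stepDF S₃ k)) (hfin₃ : FinSupp W' P₃.Sfin) (hDS₃ : ∀ k ≤ S₃.N, 𝒲₃.stepDF S₃ k ⊆ P₃.Sfin)
    (ho₃' : ∀ k ≤ S₃.N, P₃.o ∉ 𝒲₃.stepDF S₃ k) (hoS₃ : P₃.o ∈ P₃.Sfin) (hj₃ : P₃.j₁ ≤ P₃.Rlev)
    (hcount₃ : 1 / (1 - (p : ℝ)) ^ (Δ' * P₃.N) ≤ δ * ((Finset.Icc P₃.j₀ P₃.j₁).card : ℝ))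
    (hkits₃ : ∀ k ≤ S₃.N, ∀ j ∈ Finset.Icc P₃.j₀ P₃.j₁, ∃ (σ : SData V) (Sz : Finset V),
      SHyp (P₃.stepLF 𝒲₃ S₃ k) j σ ∧ σ.N ≤ P₃.N ∧ (1 - (p : ℝ) ^ σ.sB) ^ σ.k ≤ δ ∧ Sz ⊆ 𝒲₃.stepDF S₃ k ∧ (∀ x ∈ σ.K, σ.face x ⊆ Sz) ∧
      RelayClause (P₃.stepLF 𝒲₃ S₃ k) W' j σ Sz (P₃.coreEF 𝒲₃ S₃ k) (𝒲₃.stepDF S₃ k) δ)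
    (hexc₃ : ∀ k ≤ S₃.N, (prodBernoulli W').real (⋃ t ∈ P₃.Rim k, openConn P₁.o t) ≤ η) :
    let n₁₂ := S₁.N + 1 + S₂.N
    let n := n₁₂ + 1 + S₃.N
    let s : Fin (n + 1) → TStep G' := fun i => pw n₁₂ (stepAF₂ P₁ P₂ 𝒲₁ 𝒲₂ S₁ S₂) (fun k => P₃.stepAF 𝒲₃ S₃ k) i
    let T' : Fin (n + 1) → Finset V := fun i => pw n₁₂ (coreTF₂ 𝒲₁ 𝒲₂ S₁ S₂) (fun k => 𝒲₃.coreTF S₃ k) i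
    (∀ i : Fin (n + 1), (s i).L.o = P₁.o) ∧
    (∀ i : Fin n, T' (Fin.castSucc i) ⊆ (s i.succ).L.X 0) ∧ (∀ i : Fin (n + 1), T' i ⊆ (s i).T) ∧
    (∀ i : Fin (n + 1), (s i).KitsAtF W' p Δ' δ) ∧
    (∀ i : Fin (n + 1), (prodBernoulli W').real (⋃ t ∈ (s i).T \ T' i, openConn P₁.o t) ≤ η) ∧
    (s 0).L.X 0 = 𝒲₁.W (S₁.core 0) ∧ T' (Fin.last n) = 𝒲₃.coreTF S₃ S₃.N := by
  intro n₁₂ n s T'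
  -- segments 1–2
  obtain ⟨ho₁₂, hlink₁₂, hsub₁₂, hkits₁₂, hexc₁₂, h0₁₂, hlast₁₂⟩ := chainF₂ P₁ P₂ 𝒲₁ 𝒲₂ S₁ S₂ ho hRl₁ hRim₁ hTne₁ hRl₂ hRim₂ hTne₂ hx
    hsub₁ hfin₁ hDS₁ ho₁ hoS₁ hj₁ hcount₁ hkits₁ hexc₁ hsub₂ hfin₂ hDS₂ ho₂ hoS₂ hj₂ hcount₂ hkits₂ hexc₂
  -- per natural index: facts by cases at the second cut
  have hfacts : ∀ k ≤ n, pw n₁₂ (coreTF₂ 𝒲₁ 𝒲₂ S₁ S₂) (fun k => 𝒲₃.coreTF S₃ k) k ⊆ (pw n₁₂ (stepAF₂ P₁ P₂ 𝒲₁ 𝒲₂ S₁ S₂) (fun k => P₃.stepAF 𝒲₃ S₃ k) k).T ∧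
      (pw n₁₂ (stepAF₂ P₁ P₂ 𝒲₁ 𝒲₂ S₁ S₂) (fun k => P₃.stepAF 𝒲₃ S₃ k) k).KitsAtF W' p Δ' δ ∧
      (prodBernoulli W').real (⋃ t ∈ (pw n₁₂ (stepAF₂ P₁ P₂ 𝒲₁ 𝒲₂ S₁ S₂) (fun k => P₃.stepAF 𝒲₃ S₃ k) k).T \
        pw n₁₂ (coreTF₂ 𝒲₁ 𝒲₂ S₁ S₂) (fun k => 𝒲₃.coreTF S₃ k) k, openConn P₁.o t) ≤ η := by
    intro k hk
    by_cases h : k ≤ n₁₂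
    · rw [pw_of_le _ _ h, pw_of_le _ _ h]
      exact ⟨hsub₁₂ ⟨k, Nat.lt_succ_of_le h⟩, hkits₁₂ ⟨k, Nat.lt_succ_of_le h⟩, hexc₁₂ ⟨k, Nat.lt_succ_of_le h⟩⟩
    · obtain ⟨j, rfl⟩ : ∃ j, k = n₁₂ + 1 + j := ⟨k - (n₁₂ + 1), by omega⟩
      have hj : j ≤ S₃.N := by change n₁₂ + 1 + j ≤ n₁₂ + 1 + S₃.N at hk; omega
      rw [pw_add, pw_add]
      refine ⟨P₃.coreTF_subset_coreEF 𝒲₃ S₃ j, P₃.kitsAt_stepAFF 𝒲₃ S₃ hRl₃ hRim₃ hj (hTne₃ j hj) (hsub₃ j hj) hfin₃ (hDS₃ j hj) (ho₃' j hj) hoS₃ hj₃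
        hcount₃ (hkits₃ j hj), ?_⟩
      refine le_trans (measureReal_mono ?_ (measure_ne_top _ _)) (hexc₃ j hj)
      intro ω hω
      simp only [Set.mem_iUnion, exists_prop] at hω ⊢
      obtain ⟨t, ht, hωt⟩ := hω
      exact ⟨t, P₃.coreEF_sdiff_subset 𝒲₃ S₃ j ht, hωt⟩
  -- the links, by cases: inside segments 1–2, at the second frame change, inside segment 3
  have hlinks : ∀ k, k + 1 ≤ n → pw n₁₂ (coreTF₂ 𝒲₁ 𝒲₂ S₁ S₂) (fun k => 𝒲₃.coreTF S₃ k) k ⊆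
      (pw n₁₂ (stepAF₂ P₁ P₂ 𝒲₁ 𝒲₂ S₁ S₂) (fun k => P₃.stepAF 𝒲₃ S₃ k) (k + 1)).L.X 0 := by
    intro k hk
    by_cases h : k + 1 ≤ n₁₂
    · rw [pw_of_le _ _ (by omega), pw_of_le _ _ h]
      exact hlink₁₂ ⟨k, by omega⟩
    · by_cases h' : k = n₁₂
      · subst h'
        rw [pw_of_le _ _ le_rfl, show n₁₂ + 1 = n₁₂ + 1 + 0 by omega, pw_add]
        have hl : coreTF₂ 𝒲₁ 𝒲₂ S₁ S₂ n₁₂ = 𝒲₂.coreTF S₂ S₂.N := hlast₁₂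
        rw [hl]
        show 𝒲₂.coreTF S₂ S₂.N ⊆ (P₃.stepLF 𝒲₃ S₃ 0).X 0
        rw [P₃.stepLF_X_zero 𝒲₃ S₃]
        exact hx₂
      · obtain ⟨j, rfl⟩ : ∃ j, k = n₁₂ + 1 + j := ⟨k - (n₁₂ + 1), by omega⟩
        rw [pw_add, show n₁₂ + 1 + j + 1 = n₁₂ + 1 + (j + 1) by omega, pw_add]
        exact P₃.coreTF_subset_X_zero_succ 𝒲₃ S₃ j
  have hle : ∀ i : Fin (n + 1), (i : ℕ) ≤ n := fun i => Nat.lt_succ_iff.1 i.2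
  refine ⟨fun i => ?_, fun i => ?_, fun i => (hfacts i (hle i)).1, fun i => (hfacts i (hle i)).2.1, fun i => (hfacts i (hle i)).2.2, ?_, ?_⟩
  · -- constant source
    show (pw n₁₂ (stepAF₂ P₁ P₂ 𝒲₁ 𝒲₂ S₁ S₂) (fun k => P₃.stepAF 𝒲₃ S₃ k) (i : ℕ)).L.o = P₁.o
    by_cases h : (i : ℕ) ≤ n₁₂
    · rw [pw_of_le _ _ h]; exact ho₁₂ ⟨i, Nat.lt_succ_of_le h⟩
    · obtain ⟨j, hj⟩ : ∃ j, (i : ℕ) = n₁₂ + 1 + j := ⟨i - (n₁₂ + 1), by omega⟩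
      rw [hj, pw_add]; exact (P₃.stepAF_o 𝒲₃ S₃ j).trans ho₃
  · -- the links
    show pw n₁₂ (coreTF₂ 𝒲₁ 𝒲₂ S₁ S₂) (fun k => 𝒲₃.coreTF S₃ k) (Fin.castSucc i) ⊆
      (pw n₁₂ (stepAF₂ P₁ P₂ 𝒲₁ 𝒲₂ S₁ S₂) (fun k => P₃.stepAF 𝒲₃ S₃ k) (i.succ : ℕ)).L.X 0
    have e : ((i.succ : Fin (n + 1)) : ℕ) = (Fin.castSucc i : ℕ) + 1 := by simp
    rw [e]
    exact hlinks _ (by have := i.2; simp only [Fin.val_castSucc]; omega)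
  · -- the first level
    show (pw n₁₂ (stepAF₂ P₁ P₂ 𝒲₁ 𝒲₂ S₁ S₂) (fun k => P₃.stepAF 𝒲₃ S₃ k) ((0 : Fin (n + 1)) : ℕ)).L.X 0 = 𝒲₁.W (S₁.core 0)
    rw [Fin.val_zero, pw_of_le _ _ (Nat.zero_le _)]
    exact h0₁₂
  · -- the last true target
    show pw n₁₂ (coreTF₂ 𝒲₁ 𝒲₂ S₁ S₂) (fun k => 𝒲₃.coreTF S₃ k) ((Fin.last n : Fin (n + 1)) : ℕ) = 𝒲₃.coreTF S₃ S₃.N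
    rw [Fin.val_last, show n = n₁₂ + 1 + S₃.N from rfl, pw_add]

end WinChainData

end Skelφ

end Summit.CriticalPhenomena.PercolationContinuityZ3.Theorems.Transplant

end
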